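import Literature.Probability.LatticeModels.MoebiusWeightedAction
import Literature.MathematicalPhysics.QuantumLattice.RandomField
import Summits.CriticalPhenomena.Ising3DConformalLimit.Theses.PrecisionLaplacian
import Summits.CriticalPhenomena.Ising3DConformalLimit.Theorems.MoebiusLimitOfTwoPointLaw.Negative.GroupLemmaNeedsTranslation
import HarnessLib

/-!
# Crux `MoebiusLimitOfTwoPointLaw` (item stmt-CriticalPhenomena-4801): the law-level reversal identity in the tree's
# field vocabulary (line `two-shell-exchange-markov`, lead; bridge for engine lines)

The lead's verdict on this crux promotes the LAW-LEVEL half of the line (stub K2a `stub_lawReversal`): under the two-point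
law, the law of every regular limit is invariant under the Weyl-weighted origin-centred sphere inversions
`ι_λ : x ↦ λx/‖x‖²`, stated as the smeared identity
`∫ S_n(x) ∏ᵢ (λ/‖xᵢ‖²)^{3−Δ} fᵢ(ι_λ xᵢ) dx = ∫ S_n(x) ∏ᵢ fᵢ(xᵢ) dx` on smooth `fᵢ` compactly supported off the origin.
Engines that work with the LAW `μ` of the limit field on `𝒮'(ℝ³)` (`Literature.MathematicalPhysics.QuantumLattice.FieldConfig`,
moments `moment μ n f`) and with the tree's weight-`Δ` action of Möbius charts on test functions
(`Literature.Probability.LatticeModels.moebiusWeightedAction`, `ConformalChart.unitInversion`, `ConformalChart.dilation`)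
produce that identity in THEIR vocabulary: "the moments of `μ` are invariant under the pull-back along the chart
`ι.trans (dilation λ)`". This file is the dictionary:

* `moebiusWeightedAction_sphereInversion_apply`: for `f` Schwartz, compactly supported off the origin,
  `((ι.trans (dilation λ))^*_Δ f)(x) = (λ/‖x‖²)^{3−Δ} f((λ/‖x‖²) x)` for every `x` (both sides vanish at `x = 0`);
* `lawReversal_of_moment_invariance`: if `μ` has moment densities `S` and its moments are invariant under those
  pull-backs for all admissible test families, then the smeared identity of `stub_lawReversal` / of the promoted
  statement holds (for smooth compactly supported tests off the origin; the disjoint-support clause is not even needed).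

References: Di Francesco–Mathieu–Sénéchal 1997 §4.2.1 (4.32) (test functions transform as densities of weight `d − Δ`)
[FrancescoMathieuSenechal1997]; Glimm–Jaffe 1987 §6.1 (moments of a field law) [GlimmJaffe1987].
-/

noncomputable section

namespace Summit.CriticalPhenomena.Ising3DConformalLimit.PrecisionLaplacianMoebiusLimitOfTwoPointLaw

open Literature.Probability.LatticeModels Literature.MathematicalPhysics.QuantumLattice Filter Topology MeasureTheory
open Summit.CriticalPhenomena.Ising3DConformalLimit.Theorems.MoebiusLimitOfTwoPointLaw.Negative
  (sphereInversion_eq_smul_inversion)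

/-- The chart `ι.trans (dilation λ)` acts by `x ↦ (λ/‖x‖²) x`. -/
theorem chart_sphereInversion_apply {lam : ℝ} (hlam : lam ≠ 0) (x : EuclideanSpace ℝ (Fin 3)) :
    (ConformalChart.trans ConformalChart.unitInversion (ConformalChart.dilation lam hlam) :
      ConformalChart (EuclideanSpace ℝ (Fin 3))) x = (lam / ‖x‖ ^ 2) • x := by
  rw [ConformalChart.trans_apply, ConformalChart.dilation_apply, ConformalChart.unitInversion_apply,
    sphereInversion_eq_smul_inversion]

/-- A nonzero point lies in the source of `ι.trans (dilation λ)`. -/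
theorem mem_source_chart_sphereInversion {lam : ℝ} (hlam : lam ≠ 0) {x : EuclideanSpace ℝ (Fin 3)} (hx : x ≠ 0) :
    x ∈ (ConformalChart.trans ConformalChart.unitInversion (ConformalChart.dilation lam hlam) :
      ConformalChart (EuclideanSpace ℝ (Fin 3))).source := by
  rw [ConformalChart.trans_source]
  exact ⟨hx, by simp⟩

/-- The origin is not in the source of `ι.trans (dilation λ)`. -/
theorem zero_notMem_source_chart_sphereInversion {lam : ℝ} (hlam : lam ≠ 0) :
    (0 : EuclideanSpace ℝ (Fin 3)) ∉ (ConformalChart.trans ConformalChart.unitInversion (ConformalChart.dilation lam hlam) :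
      ConformalChart (EuclideanSpace ℝ (Fin 3))).source := by
  rw [ConformalChart.trans_source]
  exact fun h => h.1 rfl

/-- The complement of the origin lies in the target of `ι.trans (dilation λ)`. -/
theorem compl_zero_subset_target_chart_sphereInversion {lam : ℝ} (hlam : lam ≠ 0) :
    ({0}ᶜ : Set (EuclideanSpace ℝ (Fin 3))) ⊆ (ConformalChart.trans ConformalChart.unitInversion (ConformalChart.dilation lam hlam) :
      ConformalChart (EuclideanSpace ℝ (Fin 3))).target := by
  intro y hy
  rw [ConformalChart.trans_target]
  refine ⟨by simp, ?_⟩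
  show (ConformalChart.dilation lam hlam).symm y ∈ ConformalChart.unitInversion.source
  rw [ConformalChart.unitInversion_source]
  simp [ConformalChart.dilation, hlam, Set.mem_compl_singleton_iff.1 hy]

/-- The conformal factor of `ι.trans (dilation λ)` at `x` is `|λ|/‖x‖²`. -/
theorem chart_sphereInversion_factor {lam : ℝ} (hlam : lam ≠ 0) (x : EuclideanSpace ℝ (Fin 3)) :
    (ConformalChart.trans ConformalChart.unitInversion (ConformalChart.dilation lam hlam) :
      ConformalChart (EuclideanSpace ℝ (Fin 3))).factor x = (‖x‖ ^ 2)⁻¹ * |lam| := by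
  rw [ConformalChart.trans_factor, ConformalChart.unitInversion_factor, ConformalChart.dilation_factor]

/-- **The weight-`Δ` pull-back along `ι_λ` in coordinates.** For a Schwartz function `f` compactly supported off the
origin and `λ > 0`: `((ι.trans (dilation λ))^*_Δ f)(x) = (λ/‖x‖²)^{3−Δ} · f((λ/‖x‖²) x)` for EVERY `x`
(at `x = 0` both sides vanish: the left by definition of the action off the source, the right because `f 0 = 0`). -/
theorem moebiusWeightedAction_sphereInversion_apply {lam : ℝ} (hlam : 0 < lam) (Δ : ℝ)
    {f : SchwartzMap (EuclideanSpace ℝ (Fin 3)) ℝ} (hf : HasCompactSupport f) (hft : tsupport (f : _ → ℝ) ⊆ {0}ᶜ)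
    (x : EuclideanSpace ℝ (Fin 3)) :
    moebiusWeightedAction (ConformalChart.trans ConformalChart.unitInversion (ConformalChart.dilation lam hlam.ne') :
      ConformalChart (EuclideanSpace ℝ (Fin 3))) Δ f x =
      (lam / ‖x‖ ^ 2) ^ ((3 : ℝ) - Δ) * f ((lam / ‖x‖ ^ 2) • x) := by
  by_cases hx : x = 0
  · subst hx
    have hf0 : f 0 = 0 := image_eq_zero_of_notMem_tsupport fun h => hft h rfl
    rw [moebiusWeightedAction_apply_of_not_mem f (zero_notMem_source_chart_sphereInversion hlam.ne'),
      smul_zero, hf0, mul_zero]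
  · rw [moebiusWeightedAction_apply_of_mem hf (hft.trans (compl_zero_subset_target_chart_sphereInversion hlam.ne'))
        (mem_source_chart_sphereInversion hlam.ne' hx),
      chart_sphereInversion_factor, chart_sphereInversion_apply, finrank_euclideanSpace_fin,
      abs_of_pos hlam]
    congr 2
    rw [div_eq_mul_inv, mul_comm]

/-- **Dictionary: moment invariance of the law ⇒ the smeared reversal identity.** Let `μ` be a law on `𝒮'(ℝ³)` with
moment densities `S` (`moment μ n f = ∫ S_n ∏ fᵢ(xᵢ)` for Schwartz `fᵢ`) whose moments are invariant under the weight-`Δ`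
pull-back along every sphere-inversion chart `ι.trans (dilation λ)`, `λ > 0`, on test families compactly supported off
the origin. Then for all smooth `fᵢ` compactly supported off the origin (pairwise disjointness of the supports is
accepted as a hypothesis and not used): `∫ S_n(x) ∏ᵢ (λ/‖xᵢ‖²)^{3−Δ} fᵢ(ι_λ xᵢ) dx = ∫ S_n(x) ∏ᵢ fᵢ(xᵢ) dx` — verbatim the
conclusion of stub `stub_lawReversal` / the promoted law-level statement. -/
theorem lawReversal_of_moment_invariance :
    ∀ (Δ : ℝ) (S : CorrFamily 3) (μ : Measure (FieldConfig (EuclideanSpace ℝ (Fin 3)))),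
      (∀ (n : ℕ) (f : Fin n → SchwartzMap (EuclideanSpace ℝ (Fin 3)) ℝ),
        moment μ n f = ∫ x : Fin n → EuclideanSpace ℝ (Fin 3), S n x * ∏ i, f i (x i)) →
      (∀ (n : ℕ) (lam : ℝ) (hlam : 0 < lam) (f : Fin n → SchwartzMap (EuclideanSpace ℝ (Fin 3)) ℝ),
        (∀ i, HasCompactSupport (f i) ∧ tsupport (f i : _ → ℝ) ⊆ {0}ᶜ) →
        moment μ n (fun i => moebiusWeightedAction (ConformalChart.trans ConformalChart.unitInversion (ConformalChart.dilation lam hlam.ne') :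
      ConformalChart (EuclideanSpace ℝ (Fin 3))) Δ (f i)) = moment μ n f) →
      ∀ (n : ℕ) (lam : ℝ), 0 < lam → ∀ (f : Fin n → EuclideanSpace ℝ (Fin 3) → ℝ),
        (∀ i, ContDiff ℝ ((⊤ : ℕ∞) : WithTop ℕ∞) (f i) ∧ HasCompactSupport (f i) ∧ tsupport (f i) ⊆ {0}ᶜ) →
        (∀ i j, i ≠ j → Disjoint (tsupport (f i)) (tsupport (f j))) →
        (∫ x : Fin n → EuclideanSpace ℝ (Fin 3),
            S n x * ∏ i, ((lam / ‖x i‖ ^ 2) ^ ((3 : ℝ) - Δ) * f i ((lam / ‖x i‖ ^ 2) • x i))) =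
          ∫ x : Fin n → EuclideanSpace ℝ (Fin 3), S n x * ∏ i, f i (x i) := by
  intro Δ S μ hdens hinv n lam hlam f hf _
  -- the test family as Schwartz functions
  set F : Fin n → SchwartzMap (EuclideanSpace ℝ (Fin 3)) ℝ := fun i => (hf i).2.1.toSchwartzMap (hf i).1 with hF
  have hFf : ∀ i (y : EuclideanSpace ℝ (Fin 3)), F i y = f i y := fun i y => rfl
  have hFc : ∀ i, HasCompactSupport (F i) := fun i => (hf i).2.1
  have hFt : ∀ i, tsupport (F i : _ → ℝ) ⊆ {0}ᶜ := fun i => (hf i).2.2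
  have key := hinv n lam hlam F fun i => ⟨hFc i, hFt i⟩
  rw [hdens, hdens] at key
  have hL : (fun x : Fin n → EuclideanSpace ℝ (Fin 3) =>
      S n x * ∏ i, (moebiusWeightedAction (ConformalChart.trans ConformalChart.unitInversion (ConformalChart.dilation lam hlam.ne') :
      ConformalChart (EuclideanSpace ℝ (Fin 3))) Δ (F i)) (x i)) =
      fun x => S n x * ∏ i, ((lam / ‖x i‖ ^ 2) ^ ((3 : ℝ) - Δ) * f i ((lam / ‖x i‖ ^ 2) • x i)) := by
    funext x
    congr 1
    exact Finset.prod_congr rfl fun i _ =>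
      (moebiusWeightedAction_sphereInversion_apply hlam Δ (hFc i) (hFt i) (x i)).trans (by rw [hFf])
  have hR : (fun x : Fin n → EuclideanSpace ℝ (Fin 3) => S n x * ∏ i, (F i) (x i)) =
      fun x => S n x * ∏ i, f i (x i) := by
    funext x
    simp only [hFf]
  rw [hL, hR] at key
  exact key

end Summit.CriticalPhenomena.Ising3DConformalLimit.PrecisionLaplacianMoebiusLimitOfTwoPointLaw

end
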